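import Literature.NumberTheory.EllipticCurves.MultiplicativeUnramifiedTorsionProofs
import Literature.NumberTheory.EllipticCurves.TamagawaSubgroupProofs
import HarnessLib

/-!
# A rational point with no inertia-fixed `p`-th root on an integral multiplicative equation with
# `[X₀(K_v) : E₀] = n`, `p ∣ n` — from Kodaira–Néron over `K_v^nr`, WITHOUT the Tate curve
# (cell `b2b-bsdres`, team n1011, seat p01 GEN 4; row T-L1-KN2 FILE 1 = the local theorem;
# FILE 2 `SplitMultiplicativeWitnessKodairaNeron.lean` turns it into the A40-free Tamagawa witness)

HONEST FRAMING (cell `b2b-bsdres`, run/shared/lean/b2b/bsd-rank1-residual/, verbatim in every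
file): the goal of the cell is to DELETE the COMBINATION-SHAPED residual classes of the
Birch–Swinnerton-Dyer formula for ALL analytic-rank `≤ 1` elliptic curves over `ℚ` — "full BSD
formula for every rank `≤ 1` curve in class `C`" assembled STRICTLY from published theorems — so
that the rank-`≤ 1` remainder becomes exactly the CONSTRUCTION-SHAPED classes, which are TYPED
(missing-input `Prop`s), NOT attempted. This is not "finishing BSD". Team n1011 (N10 / N11, the
Route-G budget node): research route; no claim beyond the stated classes; nothing is booked; marks
UNCHANGED. THEOREMS ONLY: no definition, no named fact, no `sorry`, no named-fact hypothesis.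

## What

n1011-p16 (`KummerVersusUnramifiedLocal.lean`) reduced n1011-p10's per-place Tamagawa witness
`∃ u ∈ H¹_ur(K_v, E[p]), u ∉ 𝓚_v` to a `K_v`-rational point `P` NONE of whose `p`-th roots in
`E(K̄_v)` is inertia-fixed, and produced `P` at a split multiplicative place from TATE DATA — whence
the named fact `Silverman1994_thmV53_tateUniformisation` (A40) in this seat's gen-3 witness and in
the split rows of p10's MAIN. Here `P` is produced WITHOUT the Tate curve, in the setting of the
tree's `forall_inertia_map_eq_of_multiplicative_of_dvd` (`MultiplicativeUnramifiedTorsionProofs`,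
"no Tate curve"; its steps (1)–(3) verbatim). `X₀` over `𝓞_v` with `c₄ ∈ 𝓞_v^×`, `Δ = u π^n`;
`𝒪ⁿʳ` the valuation ring of `K_v^nr = (K̄_v)^{I_𝔐}`; `J = X₀ ⊗ 𝒪ⁿʳ`: (1) `[J(K_v^nr) : E₀(J)] = n`
(`LocalIndex.index_eq_of_tateNormalForm`, Silverman *ATAEC* IV.9.2 (d)); (2) HYPOTHESIS
`[X₀(K_v) : E₀(X₀)] = n` (true when the node is SPLIT, type `Iₙ`; tree
`localTamagawaNumber_eq_ordMinimalDiscriminant_of_hasSplitMultiplicativeReductionAt`, read on an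
integral model by §0); (3) a `K_v`-point lies in `E₀(X₀)` iff its image lies in `E₀(J)` (the
structure map `𝓞_v → 𝒪ⁿʳ` is local and unramified); (4) so `X₀(K_v) → J(K_v^nr)/E₀(J)` has kernel
`E₀(X₀)` and image of order `n`: ONTO; `p ∣ n` ⟹ multiplication by `p` on this finite group is not
injective (Cauchy), hence not surjective: some class `[P₀]`, `P₀ ∈ X₀(K_v)`, is no `p`-th multiple;
(5) an inertia-fixed `Q` with `p • Q = P₀` has coordinates in `K_v^nr`, so `[P₀] = p • [Q]` —
contradiction. No cyclicity of the component group is used; `v ∤ p` is not used. (Greenberg,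
LNM 1716, §3 p. 74: `|ker r_v| = c_v^{(p)}` via `E(K_v)/E₀(K_v) ≅ ℤ/c_v`.)

* §0 `index_goodReductionSubgroup_eq_of_baseChange_eq`; §1
  `exists_point_forall_exists_inertia_map_ne_of_multiplicative_of_dvd_of_index` (the local theorem).

References: J. H. Silverman, *ATAEC*, GTM 151 (1994), Cor. IV.9.2 (d) (PDF p. 340 of the held
copy); *AEC* 2nd ed. (2009), VII.2.1; R. Greenberg, LNM 1716 (1999), §3 p. 74; J. Neukirch, *ANT*
(1999), II (7.5), (9.11). Design: theorems only; `noncomputable section`; one universe `u`; the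
setting, names and `maxHeartbeats` of `forall_inertia_map_eq_of_multiplicative_of_dvd` verbatim.
-/

noncomputable section

open scoped Classical NNReal NumberField

open NumberField IsDedekindDomain Field IsLocalRing

universe u

namespace Summit.BirchSwinnertonDyer.Rank1Residual.Additive

open Literature.NumberTheory.EllipticCurves Literature.NumberTheory.EllipticCurves.LocalIndex
  Literature.NumberTheory.GaloisRepresentations
  Literature.NumberTheory.GaloisRepresentations.IsNonarchimedeanLocalField
  Literature.NumberTheory.DiophantineGeometry Literature.NumberTheory.DiophantineGeometry.TateAlgorithm
  IsDedekindDomain.HeightOneSpectrum Rat.HeightOneSpectrum WeierstrassCurve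

/-! ## §0 The index `[E(K_v) : E₀]` read on an integral model -/

section Index

variable {R : Type*} [CommRing R] [IsDomain R] [IsDiscreteValuationRing R]
  {F : Type*} [Field F] [Algebra R F] [IsFractionRing R F]

/-- For an `R`-minimal equation `M` over the fraction field `F` of a discrete valuation ring `R`
written as `M = X₀ ⊗ F` with `X₀` over `R`, the index of `E₀(F) = M.goodReductionSubgroup R`
(`Tamagawa.lean`) is the index of `X₀.nonsingularReductionSubgroup` (`ReductionHomomorphism.lean`)
— the tree's `goodReductionSubgroup_baseChange_eq`, with the model as a variable so that it can be
substituted. [folklore] -/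
theorem index_goodReductionSubgroup_eq_of_baseChange_eq (M : WeierstrassCurve F) [M.IsMinimal R]
    (X₀ : WeierstrassCurve R) (h : X₀.baseChange F = M) :
    (M.goodReductionSubgroup R).index =
      (X₀.nonsingularReductionSubgroup (integers_valuationRing_valuation R F)).index := by
  subst h
  rw [goodReductionSubgroup_baseChange_eq]

end Index

/-! ## §1 The local theorem on an integral multiplicative equation -/

section Local

variable {K : Type u} [Field K] [NumberField K] {v : HeightOneSpectrum (𝓞 K)}
  {w : Valuation (AlgebraicClosure (v.adicCompletion K)) ℝ≥0}
  (hw : ∀ x, (w x : ℝ) = spectralNorm (v.adicCompletion K) (AlgebraicClosure (v.adicCompletion K)) x)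

include hw in
set_option maxHeartbeats 4000000 in
/-- **A rational point with no inertia-fixed `p`-th root, from Kodaira–Néron (no Tate curve).**
Let `K` be a number field, `v` a finite place, `X₀` a Weierstrass equation over `𝓞_v` with
`c₄(X₀) ∈ 𝓞_v^×` and `Δ(X₀) = u π^n` (`u ∈ 𝓞_v^×`, `π` a uniformiser, `n ≥ 1`), `p` a prime with
`p ∣ n` (no hypothesis `v ∤ p`), and assume `[X₀(K_v) : E₀] = n` (true when the node is SPLIT:
Kodaira–Néron type `Iₙ`, Silverman *ATAEC* Cor. IV.9.2 (d)). Then some `K_v`-rational point `P₀` of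
`X₀` is such that EVERY `Q ∈ X₀(K̄_v)` with `p • Q = P₀` is moved by some element of the inertia
group `I_𝔐 ≤ Γ_{K_v}` (`𝔐` the prime of `\bar 𝓞_v` above `𝓂_v`). Proof: module docstring, steps
(1)–(5) (`X₀(K_v) ↠ J(K_v^nr)/E₀`, Cauchy, and `K_v^nr = (K̄_v)^{I_𝔐}`); Greenberg, LNM 1716,
p. 74 (`|ker r_v| = c_v^{(p)}`), with no cyclicity used. [cite: SilvermanATAEC1994, Cor. IV.9.2(d) (PDF p. 340)]
[cite: GreenbergLNM1716, §3 p. 74] [cite: SilvermanAEC2009, VII.2 Prop. 2.1] -/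
theorem exists_point_forall_exists_inertia_map_ne_of_multiplicative_of_dvd_of_index
    (X₀ : WeierstrassCurve (v.adicCompletionIntegers K)) {u π : v.adicCompletionIntegers K}
    (hu : IsUnit u) (hπ : Irreducible π) {n : ℕ} (hn : 1 ≤ n) (hΔ : X₀.Δ = u * π ^ n)
    (hc₄ : X₀.c₄ ∉ maximalIdeal (v.adicCompletionIntegers K))
    {p : ℕ} (hp : p.Prime) (hpn : p ∣ n)
    (hidx : (X₀.nonsingularReductionSubgroup (integers_valuationRing_valuation
      (v.adicCompletionIntegers K) (v.adicCompletion K))).index = n)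
    {𝔐 : Ideal v.localAbsIntegers} (h𝔐 : 𝔐 ∈ v.localPrimesAbove) :
    ∃ P₀ : (X₀.baseChange (v.adicCompletion K)).toAffine.Point,
      ∀ Q : ((X₀.baseChange (v.adicCompletion K)).baseChange
          (AlgebraicClosure (v.adicCompletion K))).toAffine.Point,
        p • Q = WeierstrassCurve.Affine.Point.baseChange (W' := X₀.baseChange (v.adicCompletion K))
            (v.adicCompletion K) (AlgebraicClosure (v.adicCompletion K)) P₀ →
        ∃ σ ∈ 𝔐.inertia (absoluteGaloisGroup (v.adicCompletion K)),
          WeierstrassCurve.Affine.Point.map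
            ((absoluteGaloisGroup.toAlgEquiv _ σ :
                (AlgebraicClosure (v.adicCompletion K)) ≃ₐ[(v.adicCompletion K)]
                  (AlgebraicClosure (v.adicCompletion K))) :
              (AlgebraicClosure (v.adicCompletion K)) →ₐ[(v.adicCompletion K)]
                (AlgebraicClosure (v.adicCompletion K))) Q ≠ Q := by
  -- the setting, as in `forall_inertia_map_eq_of_multiplicative_of_dvd`
  set X : WeierstrassCurve (v.adicCompletion K) := X₀.baseChange (v.adicCompletion K) with hXdef
  letI instDec : DecidableEq (maxUnramified (v.adicCompletion K)) :=
    fun a b => Classical.propDecidable (a = b)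
  haveI := isDiscreteValuationRing_unrIntegers hw
  haveI := henselianLocalRing_unrIntegers hw
  obtain ⟨φ, hφ⟩ := exists_ringHom_adicCompletionIntegers_unrIntegers hw
  have hvR := integers_valuationRing_valuation (Valuation.valuationSubring (Valuation.comap
    (algebraMap (maxUnramified (v.adicCompletion K)) (AlgebraicClosure (v.adicCompletion K))) w))
    (maxUnramified (v.adicCompletion K))
  have hinjR := IsFractionRing.injective (Valuation.valuationSubring (Valuation.comap
    (algebraMap (maxUnramified (v.adicCompletion K)) (AlgebraicClosure (v.adicCompletion K))) w))
    (maxUnramified (v.adicCompletion K))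
  have hv₀ := integers_valuationRing_valuation (v.adicCompletionIntegers K) (v.adicCompletion K)
  have hinj₀ := IsFractionRing.injective (v.adicCompletionIntegers K) (v.adicCompletion K)
  -- `X` is an elliptic curve: `Δ(X₀) = u π^n ≠ 0`
  have hΔ0 : X₀.Δ ≠ 0 := by rw [hΔ]; exact mul_ne_zero hu.ne_zero (pow_ne_zero _ hπ.ne_zero)
  haveI hXell : X.IsElliptic := by
    refine ⟨isUnit_iff_ne_zero.mpr ?_⟩
    change (X₀.map (algebraMap _ _)).Δ ≠ 0
    rw [WeierstrassCurve.map_Δ]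
    exact fun h ↦ hΔ0 (hinj₀ (by rw [h, map_zero]))
  -- multiplicative conditions on `X₀`, transferred to `J = X₀ ⊗ 𝒪ⁿʳ`
  have hπm : π ∈ maximalIdeal (v.adicCompletionIntegers K) :=
    (IsLocalRing.mem_maximalIdeal _).mpr hπ.not_isUnit
  have hΔm : X₀.Δ ∈ maximalIdeal (v.adicCompletionIntegers K) :=
    hΔ ▸ Ideal.mul_mem_left _ _ (Ideal.pow_mem_of_mem _ hπm n hn)
  set J := X₀.map φ with hJdef
  have hΔI : J.Δ ∈ maximalIdeal (Valuation.valuationSubring (Valuation.comap (algebraMap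
      (maxUnramified (v.adicCompletion K)) (AlgebraicClosure (v.adicCompletion K))) w)) := by
    rw [hJdef, WeierstrassCurve.map_Δ]; exact (map_mem_maximalIdeal_iff hw hφ _).mpr hΔm
  have hc₄I : J.c₄ ∉ maximalIdeal (Valuation.valuationSubring (Valuation.comap (algebraMap
      (maxUnramified (v.adicCompletion K)) (AlgebraicClosure (v.adicCompletion K))) w)) := by
    rw [hJdef, WeierstrassCurve.map_c₄]; exact fun h ↦ hc₄ ((map_mem_maximalIdeal_iff hw hφ _).mp h)
  have hΔI0 : J.Δ ≠ 0 := by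
    rw [hJdef, WeierstrassCurve.map_Δ]
    exact fun h0 ↦ hΔ0 (injective_of_coe_eq_algebraMap hφ (by rw [h0, map_zero]))
  -- (1) Tate normal form over the henselian `𝒪ⁿʳ`; its exponent is `n`; `[J(K_v^nr) : E₀] = n`
  have hsplit := exists_splitNode_root_unrIntegers hw J hΔI hc₄I
  obtain ⟨D, h1, h2, h3, h4, h6⟩ := J.exists_variableChange_eq_tateNormalForm hΔI hc₄I hsplit
  set J' := D • J with hJ'
  have hJ'Δ : J'.Δ ≠ 0 := fun h0 ↦ by
    rw [hJ', WeierstrassCurve.variableChange_Δ, mul_eq_zero] at h0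
    rcases h0 with h0 | h0
    · exact (D.u⁻¹ ^ 12).isUnit.ne_zero (by simpa only [Units.val_pow_eq_pow_val] using h0)
    · exact hΔI0 h0
  have ha0 : J'.a₆ ≠ 0 := fun h0 ↦ by
    apply hJ'Δ
    rw [J'.Δ_eq_of_tateNormalForm h1 h2 h3 h4, h0, zero_mul, neg_zero]
  have hϖ' : Irreducible (φ π) := irreducible_map_of_coe_eq_algebraMap hw hφ hπ
  obtain ⟨m, α, hα⟩ := IsDiscreteValuationRing.eq_unit_mul_pow_irreducible ha0 hϖ'
  have hm1 : 1 ≤ m := by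
    refine Nat.one_le_iff_ne_zero.mpr fun h0 ↦ ?_
    rw [h0, pow_zero, mul_one] at hα
    exact (IsLocalRing.mem_maximalIdeal _).mp (hα ▸ h6) α.isUnit
  -- `m = n`: compare the two factorisations of `Δ(J')`
  have hmn : m = n := by
    have hφu : IsUnit (φ u) := (isUnit_map_iff hw hφ u).mpr hu
    have h432 : IsUnit (1 + 432 * J'.a₆) := by
      by_contra hnu
      have hmem : 1 + 432 * J'.a₆ ∈ maximalIdeal _ := (IsLocalRing.mem_maximalIdeal _).mpr hnu
      have h1mem : (1 : Valuation.valuationSubring (Valuation.comap (algebraMap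
          (maxUnramified (v.adicCompletion K)) (AlgebraicClosure (v.adicCompletion K))) w)) ∈
          maximalIdeal _ := by
        have := Ideal.sub_mem _ hmem (Ideal.mul_mem_left _ 432 h6)
        rwa [add_sub_cancel_right] at this
      exact (IsLocalRing.mem_maximalIdeal _).mp h1mem isUnit_one
    have hlhs : J'.Δ = ↑((-1 : (Valuation.valuationSubring (Valuation.comap (algebraMap
        (maxUnramified (v.adicCompletion K)) (AlgebraicClosure (v.adicCompletion K))) w))ˣ) *
        α * h432.unit) * φ π ^ m := by
      rw [J'.Δ_eq_of_tateNormalForm h1 h2 h3 h4]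
      conv_lhs => rw [hα]
      simp only [Units.val_mul, Units.val_neg, Units.val_one, IsUnit.unit_spec]
      conv_rhs => rw [show (1 + 432 * J'.a₆) = (1 + 432 * (↑α * φ π ^ m)) by rw [hα]]
      ring
    have hrhs : J'.Δ = ↑((D.u⁻¹) ^ 12 * hφu.unit) * φ π ^ n := by
      rw [hJ', WeierstrassCurve.variableChange_Δ, hJdef, WeierstrassCurve.map_Δ, hΔ, map_mul,
        map_pow]
      simp only [Units.val_mul, Units.val_pow_eq_pow_val, IsUnit.unit_spec]
      ring
    exact IsDiscreteValuationRing.unit_mul_pow_congr_pow hϖ' hϖ' _ _ m n (hlhs.symm.trans hrhs)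
  have key := LocalIndex.index_eq_of_tateNormalForm (K := (maxUnramified (v.adicCompletion K)))
    J' hϖ' h1 h2 h3 h4 α.isUnit hm1 hα
  rw [hJ', index_nonsingularReductionSubgroup_smul, hmn] at key
  /- (2) the models `J ⊗ K_v^nr = X ⊗ K_v^nr` (the structure map commutes with `K_v → K_v^nr`) -/
  have hcoord : ∀ a : v.adicCompletionIntegers K,
      algebraMap (v.adicCompletion K) (maxUnramified (v.adicCompletion K))
          (algebraMap (v.adicCompletionIntegers K) (v.adicCompletion K) a) =
        algebraMap _ (maxUnramified (v.adicCompletion K)) (φ a) := fun a ↦ by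
    refine Subtype.ext ?_
    change ((algebraMap (v.adicCompletion K) (maxUnramified (v.adicCompletion K))
        (algebraMap (v.adicCompletionIntegers K) (v.adicCompletion K) a) :
          (maxUnramified (v.adicCompletion K))) : (AlgebraicClosure (v.adicCompletion K))) =
      (((φ a : (Valuation.valuationSubring (Valuation.comap (algebraMap
        (maxUnramified (v.adicCompletion K)) (AlgebraicClosure (v.adicCompletion K))) w))) :
          (maxUnramified (v.adicCompletion K))) : (AlgebraicClosure (v.adicCompletion K)))
    rw [hφ, IntermediateField.coe_algebraMap_apply]
    rfl
  have hJK : J.baseChange (maxUnramified (v.adicCompletion K)) =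
      X.baseChange (maxUnramified (v.adicCompletion K)) := by
    change (X₀.map φ).map (algebraMap _ _) =
      (X₀.map (algebraMap (v.adicCompletionIntegers K) (v.adicCompletion K))).map
        (algebraMap (v.adicCompletion K) (maxUnramified (v.adicCompletion K)))
    rw [WeierstrassCurve.map_map, WeierstrassCurve.map_map]
    exact congrArg X₀.map (RingHom.ext fun a ↦ (hcoord a).symm)
  -- the structure map `𝓞_v → 𝒪ⁿʳ` is local, so the residue fields map
  haveI hφloc : IsLocalHom φ := ⟨fun a ha ↦ by
    by_contra hna
    have hmem : a ∈ maximalIdeal (v.adicCompletionIntegers K) :=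
      (IsLocalRing.mem_maximalIdeal _).mpr (mem_nonunits_iff.mpr hna)
    have := (map_mem_maximalIdeal_iff hw hφ a).mpr hmem
    exact (mem_nonunits_iff.mp ((IsLocalRing.mem_maximalIdeal _).mp this)) ha⟩
  have hκ : J.map (residue (Valuation.valuationSubring (Valuation.comap (algebraMap
        (maxUnramified (v.adicCompletion K)) (AlgebraicClosure (v.adicCompletion K))) w))) =
      (X₀.map (residue (v.adicCompletionIntegers K))).map (IsLocalRing.ResidueField.map φ) := by
    rw [hJdef]
    simp only [WeierstrassCurve.map_map]
    congr 1
  /- (3) the maps on points `X(K_v) → X(K_v^nr) ≃ J(K_v^nr)` and `X(K_v^nr) → X(K̄_v)` -/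
  set e₁ := WeierstrassCurve.Affine.Point.congrEquiv hJK.symm with he₁
  set ιnr : X.toAffine.Point →+ (X.baseChange (maxUnramified (v.adicCompletion K))).toAffine.Point :=
    WeierstrassCurve.Affine.Point.map (W' := X)
      (Algebra.ofId (v.adicCompletion K) (maxUnramified (v.adicCompletion K))) with hιnr
  set ιX : X.toAffine.Point →+
      (X.baseChange (AlgebraicClosure (v.adicCompletion K))).toAffine.Point :=
    WeierstrassCurve.Affine.Point.map (W' := X)
      (Algebra.ofId (v.adicCompletion K) (AlgebraicClosure (v.adicCompletion K))) with hιX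
  have hinjnr : Function.Injective
      (Algebra.ofId (v.adicCompletion K) (maxUnramified (v.adicCompletion K))) :=
    fun a b hab ↦ (algebraMap (v.adicCompletion K) (maxUnramified (v.adicCompletion K))).injective hab
  set ι : (X.baseChange (maxUnramified (v.adicCompletion K))).toAffine.Point →+
      (X.baseChange (AlgebraicClosure (v.adicCompletion K))).toAffine.Point :=
    WeierstrassCurve.Affine.Point.map (W' := X)
      (IsScalarTower.toAlgHom (v.adicCompletion K) (maxUnramified (v.adicCompletion K))
        (AlgebraicClosure (v.adicCompletion K))) with hι
  have hinjι : Function.Injective ι := WeierstrassCurve.Affine.Point.map_injective (W' := X) _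
  have hιιnr : ∀ P₀ : X.toAffine.Point, ι (ιnr P₀) = ιX P₀ := fun P₀ ↦ by
    rw [hι, hιnr, hιX]
    exact WeierstrassCurve.Affine.Point.map_baseChange (W' := X) _ P₀
  -- `I_𝔐`-fixed points of `X(K̄_v)` come from `X(K_v^nr)`
  have hsurj : ∀ P : (X.baseChange (AlgebraicClosure (v.adicCompletion K))).toAffine.Point,
      (∀ σ ∈ 𝔐.inertia (absoluteGaloisGroup (v.adicCompletion K)),
        WeierstrassCurve.Affine.Point.map
          ((absoluteGaloisGroup.toAlgEquiv _ σ : (AlgebraicClosure (v.adicCompletion K))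
              ≃ₐ[(v.adicCompletion K)] (AlgebraicClosure (v.adicCompletion K))) :
            (AlgebraicClosure (v.adicCompletion K)) →ₐ[(v.adicCompletion K)]
              (AlgebraicClosure (v.adicCompletion K))) P = P) →
        ∃ Q, ι Q = P := by
    intro P hP
    rcases P with _ | ⟨x, y, h⟩
    · exact ⟨0, map_zero ι⟩
    · have hxy : ∀ σ ∈ 𝔐.inertia (absoluteGaloisGroup (v.adicCompletion K)),
          absoluteGaloisGroup.toAlgEquiv _ σ x = x ∧ absoluteGaloisGroup.toAlgEquiv _ σ y = y :=
        fun σ hσ ↦ by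
          have := hP σ hσ
          rwa [WeierstrassCurve.Affine.Point.map_some, WeierstrassCurve.Affine.Point.some.injEq] at this
      have hx : x ∈ (maxUnramified (v.adicCompletion K)) :=
        (mem_maxUnramified_iff_forall_inertia hw h𝔐).mpr fun σ hσ ↦ (hxy σ hσ).1
      have hy : y ∈ (maxUnramified (v.adicCompletion K)) :=
        (mem_maxUnramified_iff_forall_inertia hw h𝔐).mpr fun σ hσ ↦ (hxy σ hσ).2
      have hinjι' : Function.Injective (IsScalarTower.toAlgHom (v.adicCompletion K)
          (maxUnramified (v.adicCompletion K)) (AlgebraicClosure (v.adicCompletion K))) :=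
        fun a b hab ↦ Subtype.ext hab
      have h₀ : (X.baseChange (maxUnramified (v.adicCompletion K))).toAffine.Nonsingular
          ⟨x, hx⟩ ⟨y, hy⟩ :=
        (WeierstrassCurve.Affine.baseChange_nonsingular (W := X)
          (f := IsScalarTower.toAlgHom (v.adicCompletion K) (maxUnramified (v.adicCompletion K))
            (AlgebraicClosure (v.adicCompletion K))) hinjι' ⟨x, hx⟩ ⟨y, hy⟩).mp h
      exact ⟨.some _ _ h₀, rfl⟩
  /- (4) `E₀`-compatibility along `𝓞_v → 𝒪ⁿʳ` for `K_v`-points -/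
  have hE₀ : ∀ P₀ : X.toAffine.Point,
      X₀.HasNonsingularReduction P₀ ↔ J.HasNonsingularReduction (e₁ (ιnr P₀)) := by
    intro P₀
    rcases point_cases hv₀ P₀ with rfl | ⟨x, y, h, rfl, hx⟩ | ⟨a, b, h, rfl⟩
    · rw [map_zero, map_zero]
      exact ⟨fun _ ↦ WeierstrassCurve.hasNonsingularReduction_zero,
        fun _ ↦ WeierstrassCurve.hasNonsingularReduction_zero⟩
    · -- a non-integral point: in `E₁ ⊆ E₀` on both sides
      have hxK : x ∉ Set.range (algebraMap (v.adicCompletionIntegers K) (v.adicCompletion K)) :=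
        (not_mem_range_iff hv₀).mpr hx
      have hxnr : algebraMap (v.adicCompletion K) (maxUnramified (v.adicCompletion K)) x ∉
          Set.range (algebraMap (Valuation.valuationSubring (Valuation.comap (algebraMap
            (maxUnramified (v.adicCompletion K)) (AlgebraicClosure (v.adicCompletion K))) w))
            (maxUnramified (v.adicCompletion K))) := by
        rintro ⟨z, hz⟩
        apply hxK
        have hle : w (algebraMap (v.adicCompletion K) (AlgebraicClosure (v.adicCompletion K)) x)
            ≤ 1 := by
          have hzx : ((z : maxUnramified (v.adicCompletion K)) : AlgebraicClosure (v.adicCompletion K))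
              = algebraMap (v.adicCompletion K) (AlgebraicClosure (v.adicCompletion K)) x := by
            rw [← IntermediateField.coe_algebraMap_apply
              (S := maxUnramified (v.adicCompletion K)) x, ← hz]
            rfl
          rw [← hzx]
          exact coe_unrIntegers_le_one z
        have hxO := (spectralValuation_algebraMap_le_one_iff hw x).mp hle
        exact ⟨⟨x, hxO⟩, rfl⟩
      have hpt : e₁ (ιnr (.some x y h)) =
          .some (algebraMap (v.adicCompletion K) (maxUnramified (v.adicCompletion K)) x)
            (algebraMap (v.adicCompletion K) (maxUnramified (v.adicCompletion K)) y)
            (hJK.symm ▸ (WeierstrassCurve.Affine.baseChange_nonsingular (W := X) hinjnr x y).mpr h) := by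
        rw [he₁]
        exact WeierstrassCurve.Affine.Point.congrEquiv_some hJK.symm _
      rw [hpt]
      exact ⟨fun _ ↦ Or.inl hxnr, fun _ ↦ Or.inl hxK⟩
    · -- an integral point `(a, b)`: nonsingularity of `(ā, b̄)` is read in either residue field
      have h' : (J.baseChange (maxUnramified (v.adicCompletion K))).toAffine.Nonsingular
          (algebraMap _ (maxUnramified (v.adicCompletion K)) (φ a))
          (algebraMap _ (maxUnramified (v.adicCompletion K)) (φ b)) := by
        rw [← hcoord a, ← hcoord b, hJK]
        exact (WeierstrassCurve.Affine.baseChange_nonsingular (W := X)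
          (f := Algebra.ofId (v.adicCompletion K) (maxUnramified (v.adicCompletion K)))
          hinjnr _ _).mpr h
      have hpt : e₁ (ιnr (.some _ _ h)) = .some _ _ h' := by
        rw [he₁]
        exact (WeierstrassCurve.Affine.Point.congrEquiv_some hJK.symm _).trans
          (point_some_congr (hcoord a) (hcoord b))
      rw [hpt, WeierstrassCurve.hasNonsingularReduction_some_algebraMap_iff hinj₀ h,
        WeierstrassCurve.hasNonsingularReduction_some_algebraMap_iff hinjR h', hκ,
        ← IsLocalRing.ResidueField.map_residue, ← IsLocalRing.ResidueField.map_residue]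
      exact (WeierstrassCurve.Affine.map_nonsingular _
        (IsLocalRing.ResidueField.map φ).injective _ _).symm
  /- (5) `X(K_v) → J(K_v^nr)/E₀` has kernel `E₀(X₀)`, hence is onto; a class not divisible by `p` -/
  set H := J.nonsingularReductionSubgroup hvR with hH
  set f : X.toAffine.Point →+ ((J.baseChange (maxUnramified (v.adicCompletion K))).toAffine.Point ⧸ H) :=
    (QuotientAddGroup.mk' H).comp (e₁.toAddMonoidHom.comp ιnr) with hf
  have hfapply : ∀ P₀ : X.toAffine.Point, f P₀ = QuotientAddGroup.mk (e₁ (ιnr P₀)) := fun _ ↦ rfl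
  have hker : f.ker = X₀.nonsingularReductionSubgroup hv₀ := by
    ext P₀
    rw [AddMonoidHom.mem_ker, hfapply, QuotientAddGroup.eq_zero_iff, hH,
      WeierstrassCurve.mem_nonsingularReductionSubgroup_iff,
      WeierstrassCurve.mem_nonsingularReductionSubgroup_iff, hE₀]
  haveI : Fact p.Prime := ⟨hp⟩
  have hcard : Nat.card ((J.baseChange (maxUnramified (v.adicCompletion K))).toAffine.Point ⧸ H) =
      n := key
  haveI hfin : Finite ((J.baseChange (maxUnramified (v.adicCompletion K))).toAffine.Point ⧸ H) :=
    Nat.finite_of_card_ne_zero (by rw [hcard]; omega)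
  have hrange : f.range = ⊤ := by
    rw [← AddSubgroup.card_eq_iff_eq_top, hcard,
      ← Nat.card_congr (QuotientAddGroup.quotientKerEquivRange f).toEquiv, hker]
    exact hidx
  -- multiplication by `p` is not onto the quotient
  obtain ⟨c, hc⟩ : ∃ c : (J.baseChange (maxUnramified (v.adicCompletion K))).toAffine.Point ⧸ H,
      ∀ d, p • d ≠ c := by
    by_contra hall
    push Not at hall
    have hinjp : Function.Injective (fun d :
        (J.baseChange (maxUnramified (v.adicCompletion K))).toAffine.Point ⧸ H ↦ p • d) :=
      Finite.injective_iff_surjective.mpr fun c ↦ hall c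
    obtain ⟨g, hg⟩ := exists_prime_addOrderOf_dvd_card'
      (G := (J.baseChange (maxUnramified (v.adicCompletion K))).toAffine.Point ⧸ H) p
      (by rw [hcard]; exact hpn)
    have hg0 : g ≠ 0 := fun h0 ↦ by
      rw [h0, addOrderOf_zero] at hg
      exact hp.one_lt.ne' hg.symm
    have hpg : p • g = 0 := by rw [← hg, addOrderOf_nsmul_eq_zero]
    exact hg0 (hinjp (by simp only [hpg, smul_zero]))
  obtain ⟨P₀, hP₀⟩ : ∃ P₀, f P₀ = c := by rw [← AddMonoidHom.mem_range, hrange]; trivial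
  /- (6) an inertia-fixed `p`-th root of `P₀` would be `K_v^nr`-rational -/
  refine ⟨P₀, fun Q hQ ↦ ?_⟩
  by_contra hfix
  push Not at hfix
  obtain ⟨Q₁, rfl⟩ := hsurj Q hfix
  have hQ₁ : p • Q₁ = ιnr P₀ := hinjι (by rw [map_nsmul, hQ]; exact (hιιnr P₀).symm)
  apply hc (QuotientAddGroup.mk (e₁ Q₁))
  rw [← hP₀, hfapply, ← hQ₁, map_nsmul, QuotientAddGroup.mk_nsmul]

end Local

end Summit.BirchSwinnertonDyer.Rank1Residual.Additive

end
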